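import Summits.QuantumFields.YangMills.Theorems.FluctuationComparisonRegPrIntLS2BetaPosCollarCoverOfTubeChart
import HarnessLib

/-!
# S2β · POS∘ — THE TAYLOR HALF (T4): TWO MORE SOCKETS FOR THE COLLAR — INTRINSIC LOCAL GROWTH (chart-free) and GROWTH WITHIN A SLICE SET

Cell `ym3-torus` (YM ladder rung R3 = continuum `SU(2)` Yang–Mills on the three-torus at fixed lattice data — a RUNG: NOT d = 4, NOT infinite volume,
NOT a mass gap, NOT Clay).  Width seat `ym3-torus-px21` (gen 18); the (T)-chain of px8 g18's pen «Taylor half» (✓(T1) p793318, ✓(T2a) p793856, ✓(T2b) p794685, (T2c) p795315,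
✓(T2d) p794300, ✓(T2e) p795024, (T3)).  Crux `stmt-QuantumFields-20520` (`…Theses.UnitScaleTilt.FluctuationComparisonRegPrIntL`), LINE g18-1 S2β;
`--kind proof --supports stmt-QuantumFields-20520 --as helper`, count-neutral, DEFINITION-FREE (0 `def`, 0 `instance`, 0 `notation`, 0 `sorry`, default heartbeats).

WHY.  px17 g15's LOCATE-CURV-IN-19200 (20520 evidence #51) shows that the 19200 lineage holds CURV∘ (✓`hN06_holds`) and print's (142)-minimality (✓`hcoS_holds`) on the LANDAU `Σ`-slice
`X ↦ W·e^{iX}` — a transversal that is NOT the tube chart's `σ`, and whose window (19)(20)(21) is a SET of exponents, not a neighbourhood of `0` in a normed space.  (T2a)'s collar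
socket asks for growth `∀ᶠ y in 𝓝 0` along a transversal `Ψ : Y → fields`.  THIS FILE adds the two sockets a `Σ`-side (or any other) supplier can hit without passing through `σ`:
* §1 ★★★ `posCollar_of_growthOn_nhds` — CHART-FREE: if the INTRINSIC growth `c·D U ≤ A U − min` holds for every `U ∈ closure (fibre V ∩ histGood)` inside SOME neighbourhood `N` of `U₀`,
  then px8's POS∘ letter holds (by ✓(T2a) §2 `exists_orbitDist_le_imp_gaugeAct_mem`: a small orbit distance puts a residual translate of `U` in `N`; growth transfers back by
  ✓`iInf_orbitDistSq_gaugeAct_left` + ✓`wilsonAction4_gaugeAct`; the closed good fibre is residual-invariant, ✓`gaugeAct_mem_closure_inter`);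
  ★★★ `tubeGrowth_of_growthOn_nhds_of_isolated` — TUBE♭(V,U₀) ⟸ {intrinsic local growth, ISOL∘(δ)} (✓px8 door ∘ §1).
* §2 ★★★ `posCollar_of_growthWithin_of_cover` — (T2a) §4 with the growth and dictionary rows asked only WITHIN a set `S ⊆ Y` (`∀ᶠ y in 𝓝[S] 0`) and the cover producing `y ∈ S`
  (e.g. `S` = the exponents satisfying the averaging condition (20) and the Landau condition (21)); `posCollar_of_growthWithin` — dictionary discharged by (T2a) §3.

HONEST: topology∕bookkeeping; the growth letters (⟸ HESS∘ ∕ CURV∘ + (142), print's [Balaban1985Variational] p.299) and ISOL∘(δ) are DISPLAYED; TUBE-REG∘, GAP♯∘, GAP♭, EXW∘, S2β, crux 20520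
NOT proved; no summit statement is proved by a helper; finite-volume ∕ conditional; rung R3 = SU(2) YM₃ on T³ — NOT d = 4, NOT infinite volume, NOT a mass gap, NOT Clay; the Yang–Mills
mass gap is NOT proved.  Sorry-free, axioms standard.

References: T. Bałaban, CMP **102** (1985) 277–309 [Balaban1985Variational] (Thm 1 (8)–(10) p.279, (19)–(21) p.281, (142) p.299); CMP **102** (1985) 255–275 [Balaban1985UV3]
((12)–(13) p.259, (18)–(22) p.260).
-/

set_option autoImplicit false

noncomputable section

namespace Summit.QuantumFields.YangMills.Theorems.FluctuationComparisonRegPrIntLS2BetaPosCollarOfLocalGrowth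

open Set Filter Topology Function
open scoped Matrix.Norms.L2Operator
open Literature.MathematicalPhysics.QuantumFieldTheory.Balaban1983to89
open Literature.MathematicalPhysics.QuantumFieldTheory.Balaban1983to89.T3ContinuumYM3Torus
open Literature.MathematicalPhysics.QuantumFieldTheory.Balaban1983to89.T3UnitLawDensityEML (ℰp)
open Literature.MathematicalPhysics.QuantumFieldTheory.Balaban1983to89.T3UnitScaleTilt
open Literature.MathematicalPhysics.QuantumFieldTheory.Balaban1983to89.T3TiltDescent
open Literature.MathematicalPhysics.QuantumFieldTheory.Balaban1983to89.T3ConstrainedMinimiser (fibre)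
open Literature.MathematicalPhysics.QuantumFieldTheory.Balaban1983to89.T3PrintedRegularMinimiser
open Literature.MathematicalPhysics.QuantumFieldTheory.Balaban1983to89.T4Continuum
open scoped Literature.MathematicalPhysics.QuantumFieldTheory.Balaban1983to89.T3OrbitAverage
open Literature.MathematicalPhysics.QuantumFieldTheory.Balaban1983to89.Node00 (coeField)
open Summit.QuantumFields.YangMills.Theorems.FluctuationComparisonRegPrIntLS2BetaResidualGauge
open Summit.QuantumFields.YangMills.Theorems.FluctuationComparisonRegPrIntLS2BetaPosCollarOfGrowthRow
open Summit.QuantumFields.YangMills.Theorems.FluctuationComparisonRegPrIntLS2BetaPosCollarCoverOfTubeChart (gaugeAct_mem_closure_inter)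
open Summit.QuantumFields.YangMills.Theorems.FluctuationComparisonRegPrIntLS2BetaTubeGrowthOfIsolated (tubeGrowth_of_pos_of_isolated)

variable (F : T3Family) {J K : ℕ} (hJK : J ≤ K)

/-! ## §1 Chart-free: intrinsic growth on a neighbourhood of the base point -/

section Intrinsic

variable {γ b₀ p₀ ε₀ : ℝ}

/-- ★★★ **POS∘ ⟸ INTRINSIC LOCAL GROWTH** (chart-free socket).  If for some neighbourhood `N` of `U₀` and some `c > 0` the growth `c·⨅_w Σ_ℓ dist1 (U ℓ·((w•U₀) ℓ)⁻¹)² ≤ A U − minActionRegPr`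
holds for every `U ∈ N ∩ closure (fibre V ∩ histGood)`, then px8's POS∘ letter (the `hpos` binder of ✓`tubeGrowth_of_pos_of_isolated`) holds, with the same `c`.
[cite: Balaban1985Variational, (142) p.299; Balaban1985UV3, (12)-(13) p.259 and (18)-(22) p.260] -/
theorem posCollar_of_growthOn_nhds
    (V : GaugeField (F.P J) 0 (Matrix.specialUnitaryGroup (Fin 2) ℂ)) (U₀ : GaugeField (F.P K) 0 (Matrix.specialUnitaryGroup (Fin 2) ℂ)) (δ : ℝ)
    {N : Set (GaugeField (F.P K) 0 (Matrix.specialUnitaryGroup (Fin 2) ℂ))} (hN : N ∈ 𝓝 U₀) {c : ℝ} (hc : 0 < c)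
    (hgrowN : ∀ U ∈ closure (fibre F ℰp J K hJK V ∩ histGood F ℰp (θBal F.L γ b₀ p₀) K J), U ∈ N →
      c * (⨅ w : {w : Site (F.P K) 0 → Matrix.specialUnitaryGroup (Fin 2) ℂ |
            ∀ U : GaugeField (F.P K) 0 (Matrix.specialUnitaryGroup (Fin 2) ℂ),
              descendTo F ℰp J K hJK (GaugeField.gaugeAct w U) = descendTo F ℰp J K hJK U},
          ∑ ℓ : PBond (F.P K) 0,
            dist1 (U ℓ * ((GaugeField.gaugeAct (w : Site (F.P K) 0 → Matrix.specialUnitaryGroup (Fin 2) ℂ) U₀) ℓ)⁻¹) ^ 2)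
        ≤ wilsonAction4 U - minActionRegPr F J K hJK ε₀ V) :
    ∃ r c : ℝ, 0 < r ∧ 0 < c ∧
      ∀ U ∈ closure (fibre F ℰp J K hJK V ∩ histGood F ℰp (θBal F.L γ b₀ p₀) K J),
        (∃ w : Site (F.P K) 0 → Matrix.specialUnitaryGroup (Fin 2) ℂ,
          (∀ U'' : GaugeField (F.P K) 0 (Matrix.specialUnitaryGroup (Fin 2) ℂ),
              descendTo F ℰp J K hJK (GaugeField.gaugeAct w U'') = descendTo F ℰp J K hJK U'') ∧
            ∀ ℓ : PBond (F.P K) 0, dist1 (U ℓ * ((GaugeField.gaugeAct w U₀) ℓ)⁻¹) ≤ δ) →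
        (⨅ w : {w : Site (F.P K) 0 → Matrix.specialUnitaryGroup (Fin 2) ℂ |
            ∀ U : GaugeField (F.P K) 0 (Matrix.specialUnitaryGroup (Fin 2) ℂ),
              descendTo F ℰp J K hJK (GaugeField.gaugeAct w U) = descendTo F ℰp J K hJK U},
          ∑ ℓ : PBond (F.P K) 0,
            dist1 (U ℓ * ((GaugeField.gaugeAct (w : Site (F.P K) 0 → Matrix.specialUnitaryGroup (Fin 2) ℂ) U₀) ℓ)⁻¹) ^ 2) ≤ r →
        c * (⨅ w : {w : Site (F.P K) 0 → Matrix.specialUnitaryGroup (Fin 2) ℂ |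
            ∀ U : GaugeField (F.P K) 0 (Matrix.specialUnitaryGroup (Fin 2) ℂ),
              descendTo F ℰp J K hJK (GaugeField.gaugeAct w U) = descendTo F ℰp J K hJK U},
          ∑ ℓ : PBond (F.P K) 0,
            dist1 (U ℓ * ((GaugeField.gaugeAct (w : Site (F.P K) 0 → Matrix.specialUnitaryGroup (Fin 2) ℂ) U₀) ℓ)⁻¹) ^ 2)
          ≤ wilsonAction4 U - minActionRegPr F J K hJK ε₀ V := by
  obtain ⟨r, hr, hnear⟩ := exists_orbitDist_le_imp_gaugeAct_mem F hJK U₀ hN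
  refine ⟨r, c, hr, hc, fun U hU _ hUr => ?_⟩
  obtain ⟨w, hw, hwU⟩ := hnear U hUr
  have h := hgrowN (GaugeField.gaugeAct w U) (gaugeAct_mem_closure_inter F hJK hw hU) hwU
  rwa [iInf_orbitDistSq_gaugeAct_left F hJK hw, wilsonAction4_gaugeAct] at h

/-- ★★★ **TUBE♭(V,U₀) ⟸ {INTRINSIC LOCAL GROWTH, ISOL∘(δ)}** (✓px8 `tubeGrowth_of_pos_of_isolated` ∘ §1).
[cite: Balaban1985Variational, (142) p.299; Balaban1985UV3, (12)-(13) p.259 and (18)-(22) p.260] -/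
theorem tubeGrowth_of_growthOn_nhds_of_isolated
    (V : GaugeField (F.P J) 0 (Matrix.specialUnitaryGroup (Fin 2) ℂ)) (U₀ : GaugeField (F.P K) 0 (Matrix.specialUnitaryGroup (Fin 2) ℂ)) (δ : ℝ)
    {N : Set (GaugeField (F.P K) 0 (Matrix.specialUnitaryGroup (Fin 2) ℂ))} (hN : N ∈ 𝓝 U₀) {c : ℝ} (hc : 0 < c)
    (hgrowN : ∀ U ∈ closure (fibre F ℰp J K hJK V ∩ histGood F ℰp (θBal F.L γ b₀ p₀) K J), U ∈ N →
      c * (⨅ w : {w : Site (F.P K) 0 → Matrix.specialUnitaryGroup (Fin 2) ℂ |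
            ∀ U : GaugeField (F.P K) 0 (Matrix.specialUnitaryGroup (Fin 2) ℂ),
              descendTo F ℰp J K hJK (GaugeField.gaugeAct w U) = descendTo F ℰp J K hJK U},
          ∑ ℓ : PBond (F.P K) 0,
            dist1 (U ℓ * ((GaugeField.gaugeAct (w : Site (F.P K) 0 → Matrix.specialUnitaryGroup (Fin 2) ℂ) U₀) ℓ)⁻¹) ^ 2)
        ≤ wilsonAction4 U - minActionRegPr F J K hJK ε₀ V)
    (hisol : ∀ U ∈ closure (fibre F ℰp J K hJK V ∩ histGood F ℰp (θBal F.L γ b₀ p₀) K J),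
        (∃ w : Site (F.P K) 0 → Matrix.specialUnitaryGroup (Fin 2) ℂ,
          (∀ U'' : GaugeField (F.P K) 0 (Matrix.specialUnitaryGroup (Fin 2) ℂ),
              descendTo F ℰp J K hJK (GaugeField.gaugeAct w U'') = descendTo F ℰp J K hJK U'') ∧
            ∀ ℓ : PBond (F.P K) 0, dist1 (U ℓ * ((GaugeField.gaugeAct w U₀) ℓ)⁻¹) ≤ δ) →
        wilsonAction4 U ≤ minActionRegPr F J K hJK ε₀ V →
        (⨅ w : {w : Site (F.P K) 0 → Matrix.specialUnitaryGroup (Fin 2) ℂ |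
            ∀ U : GaugeField (F.P K) 0 (Matrix.specialUnitaryGroup (Fin 2) ℂ),
              descendTo F ℰp J K hJK (GaugeField.gaugeAct w U) = descendTo F ℰp J K hJK U},
          ∑ ℓ : PBond (F.P K) 0,
            dist1 (U ℓ * ((GaugeField.gaugeAct (w : Site (F.P K) 0 → Matrix.specialUnitaryGroup (Fin 2) ℂ) U₀) ℓ)⁻¹) ^ 2) = 0) :
    ∃ μ : ℝ, 0 < μ ∧ ∀ U ∈ fibre F ℰp J K hJK V, U ∈ histGood F ℰp (θBal F.L γ b₀ p₀) K J →
      (∃ w : Site (F.P K) 0 → Matrix.specialUnitaryGroup (Fin 2) ℂ,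
        (∀ U'' : GaugeField (F.P K) 0 (Matrix.specialUnitaryGroup (Fin 2) ℂ),
            descendTo F ℰp J K hJK (GaugeField.gaugeAct w U'') = descendTo F ℰp J K hJK U'') ∧
          ∀ ℓ : PBond (F.P K) 0, dist1 (U ℓ * ((GaugeField.gaugeAct w U₀) ℓ)⁻¹) ≤ δ) →
      μ * ((F.L : ℝ)⁻¹) ^ (2 * (K - J)) *
          (⨅ w : {w : Site (F.P K) 0 → Matrix.specialUnitaryGroup (Fin 2) ℂ |
              ∀ U : GaugeField (F.P K) 0 (Matrix.specialUnitaryGroup (Fin 2) ℂ),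
                descendTo F ℰp J K hJK (GaugeField.gaugeAct w U) = descendTo F ℰp J K hJK U},
            ∑ ℓ : PBond (F.P K) 0,
              dist1 (U ℓ * ((GaugeField.gaugeAct (w : Site (F.P K) 0 → Matrix.specialUnitaryGroup (Fin 2) ℂ) U₀) ℓ)⁻¹) ^ 2)
        ≤ wilsonAction4 U - minActionRegPr F J K hJK ε₀ V :=
  tubeGrowth_of_pos_of_isolated F hJK V U₀ δ (posCollar_of_growthOn_nhds F hJK V U₀ δ hN hc hgrowN) hisol

end Intrinsic

/-! ## §2 Growth within a slice set -/

section Within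

variable {Y : Type*} [NormedAddCommGroup Y] [NormedSpace ℝ Y] {γ b₀ p₀ ε₀ : ℝ}

omit [NormedSpace ℝ Y] in
/-- ★★★ **POS∘ ⟸ GROWTH WITHIN A SLICE SET + DICTIONARY + COVER INTO THE SET**: as ✓(T2a) `posCollar_of_growthRow_of_cover`, with the growth and dictionary rows asked only for `y ∈ S` near `0`
(`∀ᶠ y in 𝓝[S] 0`) and the cover producing `y ∈ S` — for transversals meaningful on a constraint set `S` (print's (20)(21): averaging + Landau conditions on the exponent).
[cite: Balaban1985Variational, (19)-(21) p.281 and (142) p.299; Balaban1985UV3, (18)-(22) p.260] -/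
theorem posCollar_of_growthWithin_of_cover
    (V : GaugeField (F.P J) 0 (Matrix.specialUnitaryGroup (Fin 2) ℂ)) (U₀ : GaugeField (F.P K) 0 (Matrix.specialUnitaryGroup (Fin 2) ℂ)) (δ : ℝ)
    (S : Set Y) (Ψ : Y → GaugeField (F.P K) 0 (Matrix.specialUnitaryGroup (Fin 2) ℂ))
    (hgrow : ∃ c₁ : ℝ, 0 < c₁ ∧ ∀ᶠ y in 𝓝[S] (0 : Y), c₁ * ‖y‖ ^ 2 ≤ wilsonAction4 (Ψ y) - minActionRegPr F J K hJK ε₀ V)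
    (hdict : ∃ C : ℝ, 0 < C ∧ ∀ᶠ y in 𝓝[S] (0 : Y),
      (⨅ w' : {w : Site (F.P K) 0 → Matrix.specialUnitaryGroup (Fin 2) ℂ |
            ∀ U : GaugeField (F.P K) 0 (Matrix.specialUnitaryGroup (Fin 2) ℂ),
              descendTo F ℰp J K hJK (GaugeField.gaugeAct w U) = descendTo F ℰp J K hJK U},
          ∑ ℓ : PBond (F.P K) 0,
            dist1 ((Ψ y) ℓ * ((GaugeField.gaugeAct (w' : Site (F.P K) 0 → Matrix.specialUnitaryGroup (Fin 2) ℂ) U₀) ℓ)⁻¹) ^ 2) ≤ C * ‖y‖ ^ 2)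
    (hcover : ∀ s ∈ 𝓝 (0 : Y), ∃ r : ℝ, 0 < r ∧
      ∀ U ∈ closure (fibre F ℰp J K hJK V ∩ histGood F ℰp (θBal F.L γ b₀ p₀) K J),
        (⨅ w' : {w : Site (F.P K) 0 → Matrix.specialUnitaryGroup (Fin 2) ℂ |
            ∀ U : GaugeField (F.P K) 0 (Matrix.specialUnitaryGroup (Fin 2) ℂ),
              descendTo F ℰp J K hJK (GaugeField.gaugeAct w U) = descendTo F ℰp J K hJK U},
          ∑ ℓ : PBond (F.P K) 0,
            dist1 (U ℓ * ((GaugeField.gaugeAct (w' : Site (F.P K) 0 → Matrix.specialUnitaryGroup (Fin 2) ℂ) U₀) ℓ)⁻¹) ^ 2) ≤ r →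
        ∃ y ∈ s ∩ S, ∃ w : Site (F.P K) 0 → Matrix.specialUnitaryGroup (Fin 2) ℂ,
          (∀ U'' : GaugeField (F.P K) 0 (Matrix.specialUnitaryGroup (Fin 2) ℂ),
              descendTo F ℰp J K hJK (GaugeField.gaugeAct w U'') = descendTo F ℰp J K hJK U'') ∧
            U = GaugeField.gaugeAct w (Ψ y)) :
    ∃ r c : ℝ, 0 < r ∧ 0 < c ∧
      ∀ U ∈ closure (fibre F ℰp J K hJK V ∩ histGood F ℰp (θBal F.L γ b₀ p₀) K J),
        (∃ w : Site (F.P K) 0 → Matrix.specialUnitaryGroup (Fin 2) ℂ,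
          (∀ U'' : GaugeField (F.P K) 0 (Matrix.specialUnitaryGroup (Fin 2) ℂ),
              descendTo F ℰp J K hJK (GaugeField.gaugeAct w U'') = descendTo F ℰp J K hJK U'') ∧
            ∀ ℓ : PBond (F.P K) 0, dist1 (U ℓ * ((GaugeField.gaugeAct w U₀) ℓ)⁻¹) ≤ δ) →
        (⨅ w : {w : Site (F.P K) 0 → Matrix.specialUnitaryGroup (Fin 2) ℂ |
            ∀ U : GaugeField (F.P K) 0 (Matrix.specialUnitaryGroup (Fin 2) ℂ),
              descendTo F ℰp J K hJK (GaugeField.gaugeAct w U) = descendTo F ℰp J K hJK U},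
          ∑ ℓ : PBond (F.P K) 0,
            dist1 (U ℓ * ((GaugeField.gaugeAct (w : Site (F.P K) 0 → Matrix.specialUnitaryGroup (Fin 2) ℂ) U₀) ℓ)⁻¹) ^ 2) ≤ r →
        c * (⨅ w : {w : Site (F.P K) 0 → Matrix.specialUnitaryGroup (Fin 2) ℂ |
            ∀ U : GaugeField (F.P K) 0 (Matrix.specialUnitaryGroup (Fin 2) ℂ),
              descendTo F ℰp J K hJK (GaugeField.gaugeAct w U) = descendTo F ℰp J K hJK U},
          ∑ ℓ : PBond (F.P K) 0,
            dist1 (U ℓ * ((GaugeField.gaugeAct (w : Site (F.P K) 0 → Matrix.specialUnitaryGroup (Fin 2) ℂ) U₀) ℓ)⁻¹) ^ 2)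
          ≤ wilsonAction4 U - minActionRegPr F J K hJK ε₀ V := by
  obtain ⟨c₁, hc₁, hgrow⟩ := hgrow
  obtain ⟨C, hC, hdict⟩ := hdict
  -- the set where both rows hold is a trace on `S` of a neighbourhood of `0`
  obtain ⟨s, hs, hsub⟩ := mem_nhdsWithin_iff_exists_mem_nhds_inter.1 (hgrow.and hdict)
  obtain ⟨r, hr, hcov⟩ := hcover s hs
  refine ⟨r, c₁ / C, hr, div_pos hc₁ hC, fun U hU _ hUr => ?_⟩
  obtain ⟨y, hy, w, hw, rfl⟩ := hcov U hU hUr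
  obtain ⟨hyg, hyd⟩ := hsub ⟨hy.1, hy.2⟩
  rw [iInf_orbitDistSq_gaugeAct_left F hJK hw, wilsonAction4_gaugeAct]
  calc c₁ / C * (⨅ w' : {w : Site (F.P K) 0 → Matrix.specialUnitaryGroup (Fin 2) ℂ |
            ∀ U : GaugeField (F.P K) 0 (Matrix.specialUnitaryGroup (Fin 2) ℂ),
              descendTo F ℰp J K hJK (GaugeField.gaugeAct w U) = descendTo F ℰp J K hJK U},
          ∑ ℓ : PBond (F.P K) 0,
            dist1 ((Ψ y) ℓ * ((GaugeField.gaugeAct (w' : Site (F.P K) 0 → Matrix.specialUnitaryGroup (Fin 2) ℂ) U₀) ℓ)⁻¹) ^ 2)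
        ≤ c₁ / C * (C * ‖y‖ ^ 2) := mul_le_mul_of_nonneg_left hyd (div_pos hc₁ hC).le
    _ = c₁ * ‖y‖ ^ 2 := by field_simp
    _ ≤ wilsonAction4 (Ψ y) - minActionRegPr F J K hJK ε₀ V := hyg

/-- ★★★ **POS∘ ⟸ GROWTH WITHIN A SLICE SET + COVER INTO THE SET, FOR A TRANSVERSAL WITH DIFFERENTIABLE MATRIX FIELD** (dictionary by ✓(T2a) §3, restricted to `S`).
[cite: Balaban1985Variational, (19)-(21) p.281 and (142) p.299; Balaban1985UV3, (18)-(22) p.260] -/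
theorem posCollar_of_growthWithin
    (V : GaugeField (F.P J) 0 (Matrix.specialUnitaryGroup (Fin 2) ℂ)) (U₀ : GaugeField (F.P K) 0 (Matrix.specialUnitaryGroup (Fin 2) ℂ)) (δ : ℝ)
    (S : Set Y) (Ψ : Y → GaugeField (F.P K) 0 (Matrix.specialUnitaryGroup (Fin 2) ℂ)) (hΨ0 : Ψ 0 = U₀)
    (hΨd : DifferentiableAt ℝ (fun y => coeField (Ψ y)) 0)
    (hgrow : ∃ c₁ : ℝ, 0 < c₁ ∧ ∀ᶠ y in 𝓝[S] (0 : Y), c₁ * ‖y‖ ^ 2 ≤ wilsonAction4 (Ψ y) - minActionRegPr F J K hJK ε₀ V)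
    (hcover : ∀ s ∈ 𝓝 (0 : Y), ∃ r : ℝ, 0 < r ∧
      ∀ U ∈ closure (fibre F ℰp J K hJK V ∩ histGood F ℰp (θBal F.L γ b₀ p₀) K J),
        (⨅ w' : {w : Site (F.P K) 0 → Matrix.specialUnitaryGroup (Fin 2) ℂ |
            ∀ U : GaugeField (F.P K) 0 (Matrix.specialUnitaryGroup (Fin 2) ℂ),
              descendTo F ℰp J K hJK (GaugeField.gaugeAct w U) = descendTo F ℰp J K hJK U},
          ∑ ℓ : PBond (F.P K) 0,
            dist1 (U ℓ * ((GaugeField.gaugeAct (w' : Site (F.P K) 0 → Matrix.specialUnitaryGroup (Fin 2) ℂ) U₀) ℓ)⁻¹) ^ 2) ≤ r →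
        ∃ y ∈ s ∩ S, ∃ w : Site (F.P K) 0 → Matrix.specialUnitaryGroup (Fin 2) ℂ,
          (∀ U'' : GaugeField (F.P K) 0 (Matrix.specialUnitaryGroup (Fin 2) ℂ),
              descendTo F ℰp J K hJK (GaugeField.gaugeAct w U'') = descendTo F ℰp J K hJK U'') ∧
            U = GaugeField.gaugeAct w (Ψ y)) :
    ∃ r c : ℝ, 0 < r ∧ 0 < c ∧
      ∀ U ∈ closure (fibre F ℰp J K hJK V ∩ histGood F ℰp (θBal F.L γ b₀ p₀) K J),
        (∃ w : Site (F.P K) 0 → Matrix.specialUnitaryGroup (Fin 2) ℂ,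
          (∀ U'' : GaugeField (F.P K) 0 (Matrix.specialUnitaryGroup (Fin 2) ℂ),
              descendTo F ℰp J K hJK (GaugeField.gaugeAct w U'') = descendTo F ℰp J K hJK U'') ∧
            ∀ ℓ : PBond (F.P K) 0, dist1 (U ℓ * ((GaugeField.gaugeAct w U₀) ℓ)⁻¹) ≤ δ) →
        (⨅ w : {w : Site (F.P K) 0 → Matrix.specialUnitaryGroup (Fin 2) ℂ |
            ∀ U : GaugeField (F.P K) 0 (Matrix.specialUnitaryGroup (Fin 2) ℂ),
              descendTo F ℰp J K hJK (GaugeField.gaugeAct w U) = descendTo F ℰp J K hJK U},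
          ∑ ℓ : PBond (F.P K) 0,
            dist1 (U ℓ * ((GaugeField.gaugeAct (w : Site (F.P K) 0 → Matrix.specialUnitaryGroup (Fin 2) ℂ) U₀) ℓ)⁻¹) ^ 2) ≤ r →
        c * (⨅ w : {w : Site (F.P K) 0 → Matrix.specialUnitaryGroup (Fin 2) ℂ |
            ∀ U : GaugeField (F.P K) 0 (Matrix.specialUnitaryGroup (Fin 2) ℂ),
              descendTo F ℰp J K hJK (GaugeField.gaugeAct w U) = descendTo F ℰp J K hJK U},
          ∑ ℓ : PBond (F.P K) 0,
            dist1 (U ℓ * ((GaugeField.gaugeAct (w : Site (F.P K) 0 → Matrix.specialUnitaryGroup (Fin 2) ℂ) U₀) ℓ)⁻¹) ^ 2)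
          ≤ wilsonAction4 U - minActionRegPr F J K hJK ε₀ V := by
  obtain ⟨C, hC, hd⟩ := exists_orbitDist_le_mul_norm_sq F hJK U₀ Ψ hΨ0 hΨd
  exact posCollar_of_growthWithin_of_cover F hJK V U₀ δ S Ψ hgrow ⟨C, hC, hd.filter_mono nhdsWithin_le_nhds⟩ hcover

end Within

end Summit.QuantumFields.YangMills.Theorems.FluctuationComparisonRegPrIntLS2BetaPosCollarOfLocalGrowth

end
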